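import Summits.CriticalPhenomena.PercolationContinuityZ3.Theorems.PercNearOneGluingNoHeavyQuantSliceMidsBelowBudget
import Summits.CriticalPhenomena.PercolationContinuityZ3.Theorems.PercNearOneGluingNoHeavyQuantSliceDeepLows
import Summits.CriticalPhenomena.PercolationContinuityZ3.Theorems.PercNearOneGluingNoHeavyQuantLightTwoBlobDEC
import Summits.CriticalPhenomena.PercolationContinuityZ3.Theorems.PercNearOneGluingNoHeavyQuantDECAtTMixtures
import HarnessLib

/-!
# QUANT lane R8, T-DEC: **THEOREM C — SL-λ* WITH TRUE MIDS BELOW THE WINDOW** (deep lows + band-like atoms + true mids `k ≤ λ` with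
# `k + a ≤ j′` + window true mids + giants; `g ≥ 1/2`) (LEAD-NOTES-G23 N50 (3))

builds on p205010 (kernel theorem, internal audit signed; external expert review pending)

Support file (`--supports stmt-CriticalPhenomena-4575`), QUANT lane lead seat prim-quant-lead (gen 23), rung R8 of
`run/shared/lean/prim/quant/LADDER.md`.  Theorems only; standard axioms, no sorries.  Assembly of Theorem C from part 1
(`…QuantSliceMidsBelowBudget`), Theorem A's core (`slice_isFlowAtT_of_deepLows_core`), the typer's light/heavy two-blob slice theorem
(`slice_decAtT_of_bdecAtT'`) and census-2's mixture lemma (`decAtT_finite_mixture`).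

**`slice_decAtT_of_midsBelow`**: probability law `ν` on `{0..M}`, `0 < x < 1`, `1 ≤ a ≤ j′`, `x ≤ g ≤ 1`, `1/2 ≤ g`, `λ ≤ j′ ≤ λ + a`;
SUPPORT: every charged low `≤ j′` deep (`2(k+a) < T′`, `k + a ≤ j′`); every charged non-low `k ≤ λ` band-like (`2k ≤ T′`) OR with `k + a ≤ j′`;
every charged atom in `(λ, j′]` a true window mid (`2k > T′`).  THEN `DECAtT x T j′ M ν ∧ DECAtT x T λ M ν ⟹ DECAtT x (T+ag) j′ (M+a) (slice ν a g)`.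
With `λ = λ*` the window-mid condition is automatic, so this is CONJECTURE SL-λ* (README V253) for every floor `x ≥ 1/2` on all supports whose
lows are deep — i.e. everything except SHALLOW lows and window lows above `λ*` (README V264: the residue).  Contains Theorem A
(`slice_decAtT_of_deepLows`) and the typer's single-low theorem.

[this work]; nothing here is cited as a published result.  The gluing rows served [cite: KozmaNitzan2024, Conjecture 3 (p. 15)]; product
measure [cite: Grimmett1999, §1.3 p. 10].
-/

noncomputable section

namespace Summit.CriticalPhenomena.PercolationContinuityZ3.Theorems

namespace Quant

open Finset

namespace LawDec

/-! ### Theorem C: assembly -/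

section MidsBelowMain

variable (x T g : ℝ) (j' M a lam : ℕ) (ν : ℕ → ℝ)

/-- `slice` is linear: `slice (c•μ + ν') = c•slice μ + slice ν'` pointwise (the form we need). -/
theorem slice_linear (μ₁ μ₂ : ℕ → ℝ) (c₁ c₂ : ℝ) (aa : ℕ) (gg : ℝ) (h : ℕ) :
    slice (fun k => c₁ * μ₁ k + c₂ * μ₂ k) aa gg h = c₁ * slice μ₁ aa gg h + c₂ * slice μ₂ aa gg h := by
  unfold slice
  split_ifs <;> ring

/-- **THEOREM C (lead g23, N50 (3)): SL-λ* WITH TRUE MIDS BELOW THE WINDOW.**  Probability law `ν` on `{0..M}`, `0 < x < 1`, `1 ≤ a ≤ j′`,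
`x ≤ g ≤ 1`, `1/2 ≤ g`, `λ ≤ j′ ≤ λ + a`.  SUPPORT: every charged low `≤ j′` is deep; every charged non-low `k ≤ λ` is band-like (`2k ≤ T′`) OR a
true mid below the window (`k + a ≤ j′`); every charged atom in `(λ, j′]` has `2k > T′`.  THEN
`DECAtT x T j′ M ν ∧ DECAtT x T λ M ν ⟹ DECAtT x (T + a·g) j′ (M + a) (slice ν a g)`.
PROOF: corner witness at `j′` (`cornerWitness`); its `M_b` columns (`mbFlow`) are sliced componentwise (`bdecAtT_subflowLaw` +
`slice_decAtT_of_bdecAtT'`), the residual datum by Theorem A's core (`slice_isFlowAtT_of_deepLows_core`) with the pool budget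
`pool_budget_midsBelow` (corner identity); the two slices recombine by `decAtT_finite_mixture`. [this work] -/
theorem slice_decAtT_of_midsBelow (hx0 : 0 < x) (hx1 : x < 1) (hxg : x ≤ g) (hg1 : g ≤ 1) (hg2 : 1 / 2 ≤ g)
    (ha : 1 ≤ a) (haj : a ≤ j') (hν : ∀ k, 0 ≤ ν k) (hνM : ∀ k, M < k → ν k = 0)
    (hν1 : ∑ h ∈ Finset.range (M + 1), ν h = 1)
    (hdj : DECAtT x T j' M ν) (hdl : DECAtT x T lam M ν) (hlamj : lam ≤ j') (hlam : j' ≤ lam + a)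
    (hdeep : ∀ k, k ≤ j' → 2 * (k : ℝ) < T → ν k ≠ 0 → 2 * ((k : ℝ) + a) < T + (a : ℝ) * g ∧ k + a ≤ j')
    (hbelow : ∀ k, k ≤ lam → T ≤ 2 * (k : ℝ) → ν k ≠ 0 → 2 * (k : ℝ) ≤ T + (a : ℝ) * g ∨ k + a ≤ j')
    (habove : ∀ k, lam < k → k ≤ j' → ν k ≠ 0 → T + (a : ℝ) * g < 2 * (k : ℝ)) :
    DECAtT x (T + (a : ℝ) * g) j' (M + a) (slice ν a g) := by
  classical
  have hg0 : 0 ≤ g := hx0.le.trans hxg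
  have hu : 0 < x / (1 - x) := div_pos hx0 (by linarith)
  -- corner certificates at the two layers
  have hCj : CornerSucceeds x T j' M ν :=
    (flowAtT_iff_cornerSucceeds x T j' M ν hx0 hx1 hν).1 (flowAtT_of_decAtT x T j' M ν hx0 hx1 hdj)
  have hCl : CornerSucceeds x T lam M ν :=
    (flowAtT_iff_cornerSucceeds x T lam M ν hx0 hx1 hν).1 (flowAtT_of_decAtT x T lam M ν hx0 hx1 hdl)
  set fB := mbFlow x T j' M a ν with hfB
  set νR := mbResidual x T j' M a ν with hνRdef
  set fR := mbResidualFlow x T j' M a ν with hfRdef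
  have hW := isFlowAtT_cornerWitness x T j' M ν hx0 hx1 hν hCj
  have hB0 : ∀ l h, 0 ≤ fB l h := fun l h => (mbFlow_nonneg_le x T j' M a ν hx0 hx1 hν hCj l h).1
  have hBle : ∀ l h, fB l h ≤ cornerWitness x T j' M ν l h :=
    fun l h => (mbFlow_nonneg_le x T j' M a ν hx0 hx1 hν hCj l h).2
  have hR : IsFlowAtT x T j' M νR fR := isFlowAtT_residual_of_subflow x T j' M ν _ fB hx0 hx1 hW hB0 hBle
  have hνR0 : ∀ k, 0 ≤ νR k := residual_nonneg_of_subflow x T j' M ν _ fB hx0 hx1 hνM hW hB0 hBle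
  have hsub0 : ∀ k, 0 ≤ subflowLaw x T j' M fB k := subflowLaw_nonneg x T j' M ν _ fB hx0 hx1 hW hB0 hBle
  have hνRle : ∀ k, νR k ≤ ν k := fun k => by
    show ν k - subflowLaw x T j' M fB k ≤ ν k; linarith [hsub0 k]
  have eR : ∀ k, νR k = ν k - subflowLaw x T j' M fB k := fun k => rfl
  have hsuble : ∀ k, subflowLaw x T j' M fB k ≤ ν k := fun k => by linarith [hνR0 k, eR k]
  have hνRM : ∀ k, M < k → νR k = 0 := fun k hk => le_antisymm (by linarith [hνRle k, hνM k hk]) (hνR0 k)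
  have hsubM : ∀ k, M < k → subflowLaw x T j' M fB k = 0 := fun k hk => le_antisymm (by linarith [hsuble k, hνM k hk]) (hsub0 k)
  have hneR : ∀ k, νR k ≠ 0 → ν k ≠ 0 := fun k hk hz => hk (le_antisymm (by linarith [hνRle k]) (hνR0 k))
  have hdeepR : ∀ k, k ≤ j' → 2 * (k : ℝ) < T → νR k ≠ 0 → 2 * ((k : ℝ) + a) < T + (a : ℝ) * g ∧ k + a ≤ j' :=
    fun k hk hlow hne => hdeep k hk hlow (hneR k hne)
  have haboveR : ∀ k, lam < k → k ≤ j' → νR k ≠ 0 → T + (a : ℝ) * g < 2 * (k : ℝ) :=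
    fun k hk hkj hne => habove k hk hkj (hneR k hne)
  -- every charged M_b pair stays below the layer after the shift
  have hBa : ∀ l h, 0 < fB l h → h + a ≤ j' := fun l h hp => (mbFlow_pos x T j' M a ν hx0 hx1 hν l h hp).1
  -- the residual datum sliced by Theorem A's core
  have hPB := pool_budget_midsBelow x T g j' M a lam ν hx0 hx1 hg0 hg1 hg2 hν hνM hlamj hlam hCj hCl hdeep hbelow habove
  have hcore := slice_isFlowAtT_of_deepLows_core x T g j' M a lam νR fR hx0 hx1 hxg hg1 ha haj hνR0 hνRM hR hlam hdeepR haboveR hPB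
  -- masses
  set c := ∑ l ∈ Finset.range (j' + 1), ∑ h ∈ Finset.range (M + 1), fB l h / (1 - pairGate x T l h) with hcdef
  have hmassB : ∑ k ∈ Finset.range (M + 1), subflowLaw x T j' M fB k = c :=
    subflowLaw_mass x T j' M ν _ fB hx0 hx1 hνM hW hB0 hBle (fun l h hp => (hBa l h hp).trans' (Nat.le_add_right h a) |> fun hh => by omega)
  have hmassR : ∑ k ∈ Finset.range (M + 1), νR k = 1 - c := by
    have : ∑ k ∈ Finset.range (M + 1), νR k = ∑ k ∈ Finset.range (M + 1), ν k - ∑ k ∈ Finset.range (M + 1), subflowLaw x T j' M fB k := by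
      rw [← Finset.sum_sub_distrib]; exact Finset.sum_congr rfl fun k _ => eR k
    rw [this, hν1, hmassB]
  have hc0 : 0 ≤ c := by rw [← hmassB]; exact Finset.sum_nonneg fun k _ => hsub0 k
  have hc1 : c ≤ 1 := by
    have : 0 ≤ ∑ k ∈ Finset.range (M + 1), νR k := Finset.sum_nonneg fun k _ => hνR0 k
    linarith
  -- degenerate masses: a nonnegative law of mass 0 vanishes
  have hsubz : c = 0 → ∀ k, subflowLaw x T j' M fB k = 0 := by
    intro hc k
    by_cases hk : k ≤ M
    · have := (Finset.sum_eq_zero_iff_of_nonneg (fun k _ => hsub0 k)).1 (hmassB.trans hc) k (Finset.mem_range.2 (by omega))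
      exact this
    · exact hsubM k (by omega)
  have hνRz : c = 1 → ∀ k, νR k = 0 := by
    intro hc k
    by_cases hk : k ≤ M
    · have h0 : ∑ k ∈ Finset.range (M + 1), νR k = 0 := by rw [hmassR, hc]; ring
      exact (Finset.sum_eq_zero_iff_of_nonneg (fun k _ => hνR0 k)).1 h0 k (Finset.mem_range.2 (by omega))
    · exact hνRM k (by omega)
  -- the two normalised slices
  set μ₁ : ℕ → ℝ := slice (fun k => subflowLaw x T j' M fB k / c) a g with hμ₁
  set μ₂ : ℕ → ℝ := slice (fun k => νR k / (1 - c)) a g with hμ₂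
  have hmix : ∀ h, slice ν a g h = c * μ₁ h + (1 - c) * μ₂ h := by
    intro h
    have eν : ν = fun k => 1 * subflowLaw x T j' M fB k + 1 * νR k := by
      funext k; show ν k = 1 * subflowLaw x T j' M fB k + 1 * (ν k - subflowLaw x T j' M fB k); ring
    have e1 : c * μ₁ h = slice (fun k => subflowLaw x T j' M fB k) a g h := by
      by_cases hc : c = 0
      · have hz := hsubz hc
        simp only [hμ₁, slice, hz, hc]; simp
      · simp only [hμ₁, slice]
        split_ifs
        · field_simp
        · simp only [mul_zero, add_zero]; field_simp
    have e2 : (1 - c) * μ₂ h = slice (fun k => νR k) a g h := by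
      by_cases hc : c = 1
      · have hz := hνRz hc
        simp only [hμ₂, slice, hz, hc]; simp
      · have hne : (1:ℝ) - c ≠ 0 := sub_ne_zero.2 (Ne.symm hc)
        simp only [hμ₂, slice]
        split_ifs
        · field_simp
        · simp only [mul_zero, add_zero]; field_simp
    rw [e1, e2, eν, slice_linear]; ring
  refine decAtT_finite_mixture x (T + (a : ℝ) * g) j' (M + a) (slice ν a g) (fun b : Bool => if b then c else 1 - c)
    (fun b => if b then μ₁ else μ₂) (fun b => by cases b <;> simp [hc0, hc1]) (by simp)
    (fun h => by simp [hmix h]) ?_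
  intro b hb
  cases b with
  | true =>
    -- the component part: BDECAtT, then the typer's light/heavy two-blob slice theorem
    rw [if_pos rfl] at hb ⊢
    have hBD := bdecAtT_subflowLaw x T j' M ν _ fB hx0 hx1 hνM hW hB0 hBle a hBa c hcdef hb
    exact slice_decAtT_of_bdecAtT' x T g j' M a _ hx0 hx1 hxg hg1 ha hBD
  | false =>
    rw [if_neg Bool.false_ne_true] at hb ⊢
    have hb' : 0 < 1 - c := hb
    -- scale the residual witness to mass one
    have hsc := hcore.smul (1 / (1 - c)) (div_nonneg zero_le_one hb'.le)
    have eμ : (fun k => 1 / (1 - c) * slice νR a g k) = μ₂ := by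
      funext k; simp only [hμ₂]; unfold slice
      split_ifs
      · field_simp
      · simp only [mul_zero, add_zero]; field_simp
    rw [eμ] at hsc
    have hflow : FlowAtT x (T + (a : ℝ) * g) j' (M + a) μ₂ := ⟨_, hsc⟩
    have hμ₂M : ∀ h, M + a < h → μ₂ h = 0 := fun h hh => by
      simp only [hμ₂]; exact slice_eq_zero _ a g M (fun k hk => by rw [hνRM k hk, zero_div]) h hh
    have hμ₂1 : ∑ h ∈ Finset.range (M + a + 1), μ₂ h = 1 := by
      simp only [hμ₂]
      refine sum_slice _ a g M (fun k hk => by rw [hνRM k hk, zero_div]) ?_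
      rw [← Finset.sum_div, hmassR, div_self hb'.ne']
    exact decAtT_of_flowAtT x _ j' (M + a) μ₂ hx0 hx1 hμ₂M hμ₂1 hflow

end MidsBelowMain

end LawDec

end Quant

end Summit.CriticalPhenomena.PercolationContinuityZ3.Theorems
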